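import Summits.ValiantsHypothesis.ValiantsHypothesis.Theorems.LacunarySymmetroidDoorA26ExtremalInverseReduction
import Summits.ValiantsHypothesis.ValiantsHypothesis.Theorems.LacunarySymmetroidDoorA26ExtremalInverseEquivalence
import Summits.ValiantsHypothesis.ValiantsHypothesis.Theorems.MatrixDescartes.Negative.MatrixDescartesWitness24
import Literature.Barriers.ValiantsHypothesis.FullRankMultilinearRank

/-!
# Route `LacunarySymmetroid` — crux `DoorA26` (stmt-ValiantsHypothesis-19979): the RANK-THREE NORMAL FORM of door A at `(2,6)`

`PosRootLawAt 2 6 19` (door A at the format `(2,6)`; it is `Theses.LacunarySymmetroid.DoorA26` by `Iff.rfl`,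
`Census.doorA26_item_iff_posRootLawAt`) says: every real symmetric `2 × 2` six-term lacunary pencil `Σ_l X^{d_l} S_l` has at most `19`
distinct positive determinant roots.  The root-space dictionary of line «extremal-inverse» (`…DoorA26ExtremalInverse{Defs,Reduction,Equivalence}`)
reads the determinant as the quadratic-form fewnomial `gramPoly d M = Σ_{i,j} M_{ij} X^{dᵢ+dⱼ}` of the Gram matrix `M = gram S`, a SYMMETROID Gram
`v vᵀ − u uᵀ − w wᵀ` (rank `≤ 3`, inertia `≤ (1,2)`), and the door becomes «no would-be Gram has the symmetroid inertia»
(`doorA26_iff_no_symmetroid_extremalGram`).  This file removes the INERTIA clause: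

* `posRootLawAt_two_six_iff_rank_le_three` — **door A at `(2,6)` ⟺ for every support `d` and every real SYMMETRIC `6 × 6` matrix `M` with
  `rank M ≤ 3`, `gramPoly d M` has at most `19` distinct positive roots**; equivalently (`posRootLawAt_two_six_iff_no_rank_three_twenty`)
  no rank-`≤ 3` symmetric matrix has twenty positive roots on the lacunary moment curve; and, literally on the proof face,
  `posRootLawAt_two_six_iff_four_le_rank_extremalGram` — **door A ⟺ every would-be Gram `extremalGram E σ r c` has rank `≥ 4`**.

Mechanism (all elementary): `trichotomy_of_rank_le_three` — by the spectral theorem in rank-one form (`eq_sum_eigenvalues_smul_vecMulVec`,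
Mathlib `Matrix.IsHermitian.spectral_theorem`) and `rank = #{non-zero eigenvalues}` (`rank_eq_card_non_zero_eigs`), a symmetric matrix of rank
`≤ 3` is a symmetroid Gram, or minus one, or `±` a SUM OF SQUARES `Σ_j a_j a_jᵀ` (the semidefinite inertias); symmetroid Grams ARE pencils
(`gram_blocks`, `det_eq_gramPoly` of `…Equivalence` / `…Reduction`), `−M` has the same roots as `M` (`gramPoly_neg`, `roots_neg`), and a sum of squares carries at most FIVE positive roots
(`card_posRoots_sos_le`: `gramPoly d (Σ a_j a_jᵀ) = Σ_j P_j²` with six-term letter polynomials `P_j = Σ_i a_{ji} X^{dᵢ}`; every positive root is a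
common root of the `P_j`, and a non-zero `P_j` has `< 6` positive roots by the tree's sparse Descartes rule
`Literature.Computability.AlgebraicComplexity.card_roots_toFinset_filter_pos_lt_card_support`).  Conversely a symmetroid Gram has rank `≤ 3`
(`rank_le_three_of_isSymmetroidGram`, via `Literature.Barriers.ValiantsHypothesis.AKV.rank_add_le'` and `Matrix.rank_vecMulVec_le`).

WHY.  The refutation face of the door can now certify a counterexample by a RATIONAL symmetric matrix of rank `≤ 3` with `21` sign alternations
(no factorisation `v vᵀ − u uᵀ − w wᵀ`, which may be irrational, is needed), and the proof face reads: «the unique `20`-root interpolant in the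
lacunary Chebyshev space has a Gram of rank `≥ 4`» — a statement about `4 × 4` minors of signed generalized-Vandermonde minors, with no inertia
bookkeeping.  Calibration in the tree: rank `6` inertia `(1,5)` twenties exist (`exists_twenty_not_twoPositive`), rank `4` inertia `(2,2)` twenties exist
(`Census.G2K6E4`); the door is exactly the rank-`3` layer.

HONEST FRAMING.  An exact reformulation (zero slack); it decides nothing about `DoorA26` (OPEN, stmt-ValiantsHypothesis-19979, never asserted here),
nor about `DoorA34`, `MatrixDescartes` (stmt-ValiantsHypothesis-18050), Conjecture B or `VP ≠ VNP`.  Closes no item (`--supports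
stmt-ValiantsHypothesis-19979`, helper).  val-sym-door-p4 g11 (cell pub-symmetroid), 2026-08-28.  [folklore] spectral theorem; Descartes' rule for
fewnomials (tree); Gram form of val-idea-4 g2 / width seat ei1 (imported).
-/

-- `Summit.ValiantsHypothesis.ValiantsHypothesis.…` repeats a component by the D-0017 layout
-- (single-conjunct summit), which the `dupNamespace` linter flags; the name is mandated.
set_option linter.dupNamespace false

namespace Summit.ValiantsHypothesis.ValiantsHypothesis.Theorems.LacunarySymmetroid.DoorA26.ExtremalInverse

open Polynomial Matrix Finset
open scoped BigOperators

/-! ### 1. Algebra of the quadratic-form fewnomial `gramPoly` -/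

/-- `gramPoly d` is additive in the matrix. [folklore] -/
theorem gramPoly_add (d : Fin 6 → ℕ) (M N : Matrix (Fin 6) (Fin 6) ℝ) :
    gramPoly d (M + N) = gramPoly d M + gramPoly d N := by
  simp only [gramPoly, Matrix.add_apply, map_add, add_mul, Finset.sum_add_distrib]

/-- `gramPoly d (−M) = −gramPoly d M`. [folklore] -/
theorem gramPoly_neg (d : Fin 6 → ℕ) (M : Matrix (Fin 6) (Fin 6) ℝ) :
    gramPoly d (-M) = -gramPoly d M := by
  simp only [gramPoly, Matrix.neg_apply, map_neg, neg_mul, Finset.sum_neg_distrib]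

/-- `gramPoly d (M − N) = gramPoly d M − gramPoly d N`. [folklore] -/
theorem gramPoly_sub (d : Fin 6 → ℕ) (M N : Matrix (Fin 6) (Fin 6) ℝ) :
    gramPoly d (M - N) = gramPoly d M - gramPoly d N := by
  rw [sub_eq_add_neg, gramPoly_add, gramPoly_neg, ← sub_eq_add_neg]

/-- `gramPoly d` of a finite sum of matrices. [folklore] -/
theorem gramPoly_sum {ι : Type*} (d : Fin 6 → ℕ) (s : Finset ι) (M : ι → Matrix (Fin 6) (Fin 6) ℝ) :
    gramPoly d (∑ j ∈ s, M j) = ∑ j ∈ s, gramPoly d (M j) := by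
  classical
  induction s using Finset.induction_on with
  | empty => simp [gramPoly]
  | insert a s ha ih => rw [Finset.sum_insert ha, Finset.sum_insert ha, gramPoly_add, ih]

/-- The quadratic-form fewnomial of a rank-one square `a aᵀ` is the square of the letter polynomial `Σ_i a_i X^{d_i}`. [folklore] -/
theorem gramPoly_vecMulVec (d : Fin 6 → ℕ) (a : Fin 6 → ℝ) :
    gramPoly d (Matrix.vecMulVec a a) = (∑ i, C (a i) * X ^ d i) ^ 2 := by
  rw [sq, Finset.sum_mul_sum]
  unfold gramPoly
  refine Finset.sum_congr rfl fun i _ => Finset.sum_congr rfl fun j _ => ?_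
  simp only [Matrix.vecMulVec_apply, map_mul, pow_add]
  ring

/-! ### 2. Letter polynomials: at most six monomials, hence at most five positive roots unless zero -/

/-- The support of a letter polynomial `Σ_i a_i X^{d_i}` lies in the image of `d`. [folklore] -/
theorem support_letterPoly_subset (d : Fin 6 → ℕ) (a : Fin 6 → ℝ) :
    (∑ i, C (a i) * X ^ d i : ℝ[X]).support ⊆ Finset.univ.image d := by
  intro n hn
  rw [Polynomial.mem_support_iff, Polynomial.finsetSum_coeff] at hn
  by_contra hni
  apply hn
  refine Finset.sum_eq_zero fun i _ => ?_
  rw [Polynomial.coeff_C_mul, Polynomial.coeff_X_pow]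
  have : n ≠ d i := by
    intro h; exact hni (Finset.mem_image.2 ⟨i, Finset.mem_univ _, h.symm⟩)
  simp [this]

/-- A nonzero letter polynomial has at most five distinct positive roots (sparse Descartes: fewer roots than monomials). [folklore] -/
theorem card_posRoots_letterPoly_le (d : Fin 6 → ℕ) (a : Fin 6 → ℝ) (h : (∑ i, C (a i) * X ^ d i : ℝ[X]) ≠ 0) :
    ((∑ i, C (a i) * X ^ d i : ℝ[X]).roots.toFinset.filter (fun t => 0 < t)).card ≤ 5 := by
  have hlt := Literature.Computability.AlgebraicComplexity.card_roots_toFinset_filter_pos_lt_card_support h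
  have hsup : (∑ i, C (a i) * X ^ d i : ℝ[X]).support.card ≤ 6 :=
    (Finset.card_le_card (support_letterPoly_subset d a)).trans
      (Finset.card_image_le.trans (by simp))
  omega

/-! ### 3. Sums of squares: a Gram matrix `Σ_j a_j a_jᵀ` carries at most five positive roots -/

/-- If `M = Σ_{j ∈ t} a_j a_jᵀ` (a sum of squares), then `gramPoly d M` has at most five distinct positive roots:
either every letter polynomial vanishes (and then `gramPoly d M = 0` has no roots) or the roots are among those of a nonzero
letter polynomial. [folklore] -/
theorem card_posRoots_sos_le (d : Fin 6 → ℕ) (t : Finset (Fin 6)) (a : Fin 6 → Fin 6 → ℝ) :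
    ((gramPoly d (∑ j ∈ t, Matrix.vecMulVec (a j) (a j))).roots.toFinset.filter (fun t => 0 < t)).card ≤ 5 := by
  rw [gramPoly_sum]
  simp_rw [gramPoly_vecMulVec]
  set P : Fin 6 → ℝ[X] := fun j => ∑ i, C (a j i) * X ^ d i with hP
  by_cases hall : ∀ j ∈ t, P j = 0
  · have : (∑ j ∈ t, P j ^ 2) = 0 := Finset.sum_eq_zero fun j hj => by rw [hall j hj]; simp
    simp only [hP] at this
    rw [this]; simp
  push Not at hall
  obtain ⟨j₀, hj₀, hne⟩ := hall
  -- every positive root of the sum of squares is a root of `P j₀`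
  refine le_trans (Finset.card_le_card ?_) (card_posRoots_letterPoly_le d (a j₀) hne)
  intro x hx
  simp only [Finset.mem_filter, Multiset.mem_toFinset] at hx ⊢
  refine ⟨?_, hx.2⟩
  obtain ⟨hx1, hx2⟩ := hx
  have hQ : (∑ j ∈ t, (∑ i, C (a j i) * X ^ d i : ℝ[X]) ^ 2) ≠ 0 := (Polynomial.mem_roots'.1 hx1).1
  have hroot := (Polynomial.mem_roots'.1 hx1).2
  rw [Polynomial.IsRoot, Polynomial.eval_finsetSum] at hroot
  simp only [Polynomial.eval_pow] at hroot
  have hterm : ∀ j ∈ t, ((∑ i, C (a j i) * X ^ d i : ℝ[X]).eval x) ^ 2 = 0 := by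
    intro j hj
    have hnn : ∀ k ∈ t, 0 ≤ ((∑ i, C (a k i) * X ^ d i : ℝ[X]).eval x) ^ 2 := fun k _ => sq_nonneg _
    exact (Finset.sum_eq_zero_iff_of_nonneg hnn).1 hroot j hj
  have h0 : (∑ i, C (a j₀ i) * X ^ d i : ℝ[X]).eval x = 0 := by
    have := hterm j₀ hj₀
    exact pow_eq_zero_iff (n := 2) (by norm_num) |>.1 this
  exact Polynomial.mem_roots'.2 ⟨hne, h0⟩


/-! ### 4. Spectral decomposition: a real symmetric matrix is a signed sum of rank-one squares -/

/-- Spectral theorem, rank-one form: `M = Σ_j λ_j u_j u_jᵀ` with `λ = hA.eigenvalues`, `u_j` the orthonormal eigenvectors. [folklore] -/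
theorem eq_sum_eigenvalues_smul_vecMulVec (M : Matrix (Fin 6) (Fin 6) ℝ) (hA : M.IsHermitian) :
    M = ∑ j, hA.eigenvalues j • Matrix.vecMulVec (⇑(hA.eigenvectorBasis j)) (⇑(hA.eigenvectorBasis j)) := by
  have h := hA.spectral_theorem
  rw [Unitary.conjStarAlgAut_apply] at h
  ext i k
  conv_lhs => rw [h]
  simp only [Matrix.mul_apply, Matrix.diagonal_apply, Function.comp_apply, RCLike.ofReal_real_eq_id, id,
    Matrix.sum_apply, Matrix.smul_apply, Matrix.vecMulVec_apply, smul_eq_mul]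
  simp [Matrix.IsHermitian.eigenvectorUnitary_apply, Matrix.star_apply, Finset.sum_ite_eq', mul_comm, mul_assoc]

/-- `(r u)(r u)ᵀ = r² · u uᵀ`. [folklore] -/
theorem vecMulVec_smul_self (r : ℝ) (u : Fin 6 → ℝ) :
    Matrix.vecMulVec (r • u) (r • u) = (r * r) • Matrix.vecMulVec u u := by
  rw [Matrix.smul_vecMulVec, Matrix.vecMulVec_smul, smul_smul]

/-- A signed rank-one term is `± a aᵀ` with `a = √|c| · u`, or `0`. [folklore] -/
theorem smul_vecMulVec_eq_ite (c : ℝ) (u : Fin 6 → ℝ) :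
    c • Matrix.vecMulVec u u =
      (if 0 < c then Matrix.vecMulVec (Real.sqrt |c| • u) (Real.sqrt |c| • u) else 0) -
      (if c < 0 then Matrix.vecMulVec (Real.sqrt |c| • u) (Real.sqrt |c| • u) else 0) := by
  rw [vecMulVec_smul_self, Real.mul_self_sqrt (abs_nonneg c)]
  rcases lt_trichotomy c 0 with hc | hc | hc
  · rw [if_neg (not_lt.2 hc.le), if_pos hc, abs_of_neg hc, zero_sub, neg_smul, neg_neg]
  · subst hc; simp
  · rw [if_pos hc, if_neg (not_lt.2 hc.le), abs_of_pos hc, sub_zero]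

/-- A sum of at most one square is a square (possibly of `0`). [folklore] -/
theorem exists_eq_vecMulVec_of_card_le_one (s : Finset (Fin 6)) (a : Fin 6 → Fin 6 → ℝ) (hs : s.card ≤ 1) :
    ∃ v : Fin 6 → ℝ, ∑ j ∈ s, Matrix.vecMulVec (a j) (a j) = Matrix.vecMulVec v v := by
  rcases Nat.le_one_iff_eq_zero_or_eq_one.1 hs with h0 | h1
  · refine ⟨0, ?_⟩
    rw [Finset.card_eq_zero.1 h0, Finset.sum_empty, Matrix.vecMulVec_zero]
  · obtain ⟨j, rfl⟩ := Finset.card_eq_one.1 h1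
    exact ⟨a j, by rw [Finset.sum_singleton]⟩

/-- A sum of at most two squares is a sum of exactly two squares (padding with `0`). [folklore] -/
theorem exists_eq_two_vecMulVec_of_card_le_two (s : Finset (Fin 6)) (a : Fin 6 → Fin 6 → ℝ) (hs : s.card ≤ 2) :
    ∃ u w : Fin 6 → ℝ, ∑ j ∈ s, Matrix.vecMulVec (a j) (a j) = Matrix.vecMulVec u u + Matrix.vecMulVec w w := by
  rcases Nat.lt_or_ge s.card 2 with hlt | hge
  · obtain ⟨v, hv⟩ := exists_eq_vecMulVec_of_card_le_one s a (by omega)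
    exact ⟨v, 0, by rw [hv, Matrix.vecMulVec_zero, add_zero]⟩
  · have h2 : s.card = 2 := le_antisymm hs hge
    obtain ⟨x, y, hxy, rfl⟩ := Finset.card_eq_two.1 h2
    exact ⟨a x, a y, by rw [Finset.sum_pair hxy]⟩

/-- **Trichotomy for symmetric matrices of rank `≤ 3`.**  A real symmetric `6 × 6` matrix of rank at most three is a symmetroid
Gram `v vᵀ − u uᵀ − w wᵀ`, or the negative of one, or `±` a sum of squares `Σ a_j a_jᵀ` (the semidefinite inertias `(3,0)`, `(0,3)`).
Spectral theorem + counting the signs of the (at most three) non-zero eigenvalues. [folklore] -/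
theorem trichotomy_of_rank_le_three (M : Matrix (Fin 6) (Fin 6) ℝ) (hM : M.IsSymm) (hr : M.rank ≤ 3) :
    IsSymmetroidGram M ∨ IsSymmetroidGram (-M) ∨
      (∃ (t : Finset (Fin 6)) (a : Fin 6 → Fin 6 → ℝ), M = ∑ j ∈ t, Matrix.vecMulVec (a j) (a j)) ∨
      (∃ (t : Finset (Fin 6)) (a : Fin 6 → Fin 6 → ℝ), -M = ∑ j ∈ t, Matrix.vecMulVec (a j) (a j)) := by
  classical
  have hA : M.IsHermitian := Matrix.isHermitian_iff_isSymm.2 hM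
  set lam := hA.eigenvalues with hlam
  set a : Fin 6 → Fin 6 → ℝ := fun j => Real.sqrt |lam j| • ⇑(hA.eigenvectorBasis j) with ha
  set P := Finset.univ.filter (fun j => 0 < lam j) with hP
  set N := Finset.univ.filter (fun j => lam j < 0) with hN
  -- the signed decomposition `M = Σ_P a aᵀ − Σ_N a aᵀ`
  have hdec : M = ∑ j ∈ P, Matrix.vecMulVec (a j) (a j) - ∑ j ∈ N, Matrix.vecMulVec (a j) (a j) := by
    conv_lhs => rw [eq_sum_eigenvalues_smul_vecMulVec M hA]
    simp_rw [smul_vecMulVec_eq_ite]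
    rw [Finset.sum_sub_distrib, Finset.sum_ite, Finset.sum_ite]
    simp [hP, hN, ha, hlam]
  -- counting: `#P + #N = rank M ≤ 3`
  have hcard : P.card + N.card ≤ 3 := by
    have hZ : M.rank = (Finset.univ.filter (fun j => lam j ≠ 0)).card := by
      rw [hA.rank_eq_card_non_zero_eigs, Fintype.card_subtype]
    have hPN : Finset.univ.filter (fun j => lam j ≠ 0) = P ∪ N := by
      ext j
      simp only [hP, hN, Finset.mem_filter, Finset.mem_union, Finset.mem_univ, true_and]
      exact ne_iff_lt_or_gt.trans or_comm
    have hdisj : Disjoint P N := by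
      rw [hP, hN, Finset.disjoint_filter]; intro j _ h1 h2; exact lt_asymm h1 h2
    rw [hPN, Finset.card_union_of_disjoint hdisj] at hZ
    omega
  -- cases on the sign counts
  by_cases hN3 : N.card = 3
  · -- inertia (0,3): `−M` is a sum of squares
    right; right; right
    have hP0 : P.card = 0 := by omega
    refine ⟨N, a, ?_⟩
    rw [hdec, Finset.card_eq_zero.1 hP0, Finset.sum_empty, zero_sub, neg_neg]
  by_cases hP3 : P.card = 3
  · -- inertia (3,0): `M` is a sum of squares
    right; right; left
    have hN0 : N.card = 0 := by omega
    refine ⟨P, a, ?_⟩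
    rw [hdec, Finset.card_eq_zero.1 hN0, Finset.sum_empty, sub_zero]
  by_cases hP1 : P.card ≤ 1
  · -- `#P ≤ 1`, `#N ≤ 2`: symmetroid
    left
    obtain ⟨v, hv⟩ := exists_eq_vecMulVec_of_card_le_one P a hP1
    obtain ⟨u, w, huw⟩ := exists_eq_two_vecMulVec_of_card_le_two N a (by omega)
    exact ⟨v, u, w, by rw [hdec, hv, huw, sub_add_eq_sub_sub]⟩
  · -- `#P = 2`, `#N ≤ 1`: `−M` is symmetroid
    right; left
    obtain ⟨v, hv⟩ := exists_eq_vecMulVec_of_card_le_one N a (by omega)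
    obtain ⟨u, w, huw⟩ := exists_eq_two_vecMulVec_of_card_le_two P a (by omega)
    exact ⟨v, u, w, by rw [hdec, hv, huw, neg_sub, sub_add_eq_sub_sub]⟩

/-! ### 5. Rank of a symmetroid Gram; the symmetric blocks of a symmetroid Gram -/

/-- A symmetroid Gram `v vᵀ − u uᵀ − w wᵀ` has rank at most `3`. [folklore] -/
theorem rank_le_three_of_isSymmetroidGram (M : Matrix (Fin 6) (Fin 6) ℝ) (h : IsSymmetroidGram M) : M.rank ≤ 3 := by
  obtain ⟨v, u, w, rfl⟩ := h
  rw [sub_eq_add_neg, sub_eq_add_neg, ← Matrix.neg_vecMulVec, ← Matrix.neg_vecMulVec]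
  refine (Literature.Barriers.ValiantsHypothesis.AKV.rank_add_le' _ _).trans ?_
  refine (Nat.add_le_add_right (Literature.Barriers.ValiantsHypothesis.AKV.rank_add_le' _ _) _).trans ?_
  have h1 := Matrix.rank_vecMulVec_le v v
  have h2 := Matrix.rank_vecMulVec_le (-u) u
  have h3 := Matrix.rank_vecMulVec_le (-w) w
  omega

/-- The blocks `[[v_l + u_l, w_l], [w_l, v_l − u_l]]` are symmetric. [folklore] -/
theorem blocks_isSymm (v u w : Fin 6 → ℝ) (l : Fin 6) : (!![v l + u l, w l; w l, v l - u l] : Matrix (Fin 2) (Fin 2) ℝ).IsSymm := by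
  refine Matrix.IsSymm.ext fun i j => ?_
  fin_cases i <;> fin_cases j <;> simp

/-! ### 6. The rank-three normal form of door A -/

/-- **`PosRootLawAt 2 6 19` (door A at `(2,6)`, = `Theses.LacunarySymmetroid.DoorA26` by `Iff.rfl`, `Census.doorA26_item_iff_posRootLawAt`)
is EQUIVALENT to: every real SYMMETRIC `6 × 6` matrix `M` of RANK `≤ 3` has a quadratic-form fewnomial `gramPoly d M = Σ M_ij X^{dᵢ+dⱼ}` with at
most `19` distinct positive roots, on every support `d`.**  No inertia hypothesis is needed: by the trichotomy the semidefinite rank-`≤ 3` matrices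
carry at most `5` positive roots (sums of squares of six-term letter polynomials), the symmetroid ones ARE pencils (Gram form), and `−M` has the
same roots as `M`. [folklore] -/
theorem posRootLawAt_two_six_iff_rank_le_three :
    Summit.ValiantsHypothesis.ValiantsHypothesis.Theorems.MatrixDescartes.Negative.PosRootLawAt 2 6 19 ↔
      ∀ (d : Fin 6 → ℕ) (M : Matrix (Fin 6) (Fin 6) ℝ), M.IsSymm → M.rank ≤ 3 →
        ((gramPoly d M).roots.toFinset.filter (fun t => 0 < t)).card ≤ 19 := by
  constructor
  · intro hlaw d M hM hr
    -- symmetroid Grams are pencils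
    have hsym : ∀ M' : Matrix (Fin 6) (Fin 6) ℝ, IsSymmetroidGram M' →
        ((gramPoly d M').roots.toFinset.filter (fun t => 0 < t)).card ≤ 19 := by
      intro M' hM'
      obtain ⟨v, u, w, rfl⟩ := hM'
      have h := hlaw d (fun l => !![v l + u l, w l; w l, v l - u l]) (blocks_isSymm v u w)
      rwa [det_eq_gramPoly d _ (blocks_isSymm v u w), gram_blocks] at h
    have hneg : ∀ M' : Matrix (Fin 6) (Fin 6) ℝ, (gramPoly d (-M')).roots = (gramPoly d M').roots := by
      intro M'; rw [gramPoly_neg, Polynomial.roots_neg]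
    rcases trichotomy_of_rank_le_three M hM hr with h1 | h2 | ⟨t, a, h3⟩ | ⟨t, a, h4⟩
    · exact hsym M h1
    · rw [← hneg]; exact hsym (-M) h2
    · rw [h3]; exact (card_posRoots_sos_le d t a).trans (by norm_num)
    · rw [← hneg, h4]; exact (card_posRoots_sos_le d t a).trans (by norm_num)
  · intro hrank d S hS
    rw [det_eq_gramPoly d S hS]
    exact hrank d (gram S) (gram_isSymm S) (rank_le_three_of_isSymmetroidGram _ (gram_isSymmetroidGram S))

/-- The rank-three normal form in the `gramPoly`-free pencil currency of the route item: door A at `(2,6)` holds iff NO real symmetric `6 × 6`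
matrix of rank `≤ 3` has twenty distinct positive roots on the lacunary moment curve. [folklore] -/
theorem posRootLawAt_two_six_iff_no_rank_three_twenty :
    Summit.ValiantsHypothesis.ValiantsHypothesis.Theorems.MatrixDescartes.Negative.PosRootLawAt 2 6 19 ↔
      ¬ ∃ (d : Fin 6 → ℕ) (M : Matrix (Fin 6) (Fin 6) ℝ), M.IsSymm ∧ M.rank ≤ 3 ∧
        20 ≤ ((gramPoly d M).roots.toFinset.filter (fun t => 0 < t)).card := by
  rw [posRootLawAt_two_six_iff_rank_le_three]
  constructor
  · rintro h ⟨d, M, hM, hr, h20⟩; have := h d M hM hr; omega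
  · intro h d M hM hr
    by_contra hlt
    exact h ⟨d, M, hM, hr, by omega⟩


/-- **The PROOF FACE, literally: door A at `(2,6)` holds iff EVERY `K = 6` would-be Gram has rank at least `4`.**
(`extremalGram E σ r c` = the Gram read off twenty prescribed sorted positive roots on a Sidon support with position data `(E, σ)`, `c ≠ 0`;
its fewnomial has those twenty roots, `card_roots_gramPoly_extremalGram`; conversely every symmetric matrix with twenty roots is a would-be
Gram, `stub_extremalInverse`.)  So `DoorA26` is the statement that no `4 × 4` minors-vanishing pattern (rank `≤ 3`) occurs among the signed maximal
minors of the `20 × 21` generalized Vandermonde at twenty positive points — with NO inertia side condition. [folklore] -/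
theorem posRootLawAt_two_six_iff_four_le_rank_extremalGram :
    Summit.ValiantsHypothesis.ValiantsHypothesis.Theorems.MatrixDescartes.Negative.PosRootLawAt 2 6 19 ↔
      ∀ (d : Fin 6 → ℕ) (E : Fin 21 → ℕ) (σ : Fin 6 → Fin 6 → Fin 21) (r : Fin 20 → ℝ) (c : ℝ),
        StrictMono E → (∀ i j, σ i j = σ j i) → (∀ i j, E (σ i j) = d i + d j) → (∀ k, ∃ i j, σ i j = k) →
        StrictMono r → 0 < r 0 → c ≠ 0 → 4 ≤ (extremalGram E σ r c).rank := by
  rw [posRootLawAt_two_six_iff_rank_le_three]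
  constructor
  · intro h d E σ r c hE hσ hEσ hsurj hr hr0 hc
    by_contra hlt
    have h19 := h d (extremalGram E σ r c) (extremalGram_isSymm E σ hσ r c) (by omega)
    have h20 := card_roots_gramPoly_extremalGram d E σ r c hE hσ hEσ hsurj hr hr0 hc
    omega
  · intro h d M hM hr
    by_contra hlt
    obtain ⟨E, σ, r, c, hE, hσ, hEσ, hsurj, hrm, hr0, hc, hMe⟩ := stub_extremalInverse d M hM (by omega)
    have h4 := h d E σ r c hE hσ hEσ hsurj hrm hr0 hc
    rw [← hMe] at h4
    omega

end Summit.ValiantsHypothesis.ValiantsHypothesis.Theorems.LacunarySymmetroid.DoorA26.ExtremalInverse
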